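import Mathlib
import Summits.ValiantsHypothesis.ValiantsHypothesis.Theses.LacunarySymmetroid
import Summits.ValiantsHypothesis.ValiantsHypothesis.Theorems.LacunarySymmetroidMatrixDescartesCensusRealExponents

/-!
# `MatrixDescartes` census — `DoorA26` / `DoorA34` over REAL exponents, and the OPENNESS of their residue

HONEST FRAMING.  Object-search cell `pub-symmetroid`, items `DoorA26 = PosRootLawAt 2 6 19`
(stmt-ValiantsHypothesis-19979) and `DoorA34 = PosRootLawAt 3 4 18` (stmt-ValiantsHypothesis-19980),
both OPEN, typed, never asserted.  This file proves EQUIVALENCES and a STRUCTURE theorem about them;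
it decides neither.  Nothing here bears on `MatrixDescartes` (stmt-ValiantsHypothesis-18050) or on
`VP ≠ VNP`.

* `posRootLawAt_iff_rpow` — for a SHARP bound `B` (`#{λ : Fin m → Fin K monotone} ≤ B + 2`, i.e.
  `B ≥` Descartes ceiling `− 1`) the integer-support row `PosRootLawAt m K B` is equivalent to the
  same bound for pencils `∑_l x^{δ_l} S_l` with arbitrary REAL exponent vectors `δ : Fin K → ℝ`
  (`x > 0`, real powers, zeros counted by `Set.ncard`).  `⇐`: `δ = d`.  `⇒`: persistent sign
  brackets (`exists_persistent_brackets`, companion file) + a point of `(1/D)·ℤ^K` in the ball +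
  the substitution `x = y^D` with the monomial shift `y^M` (`exists_nat_support`) produce an
  INTEGER support with `≥ B + 1` distinct positive roots.  HONEST LIMIT: nothing is claimed for
  non-sharp bounds (e.g. the `V = 19` rows `PosRootLawOn 2 6 18`), where zeros of even multiplicity
  may disappear under perturbation of the exponents;
* `isOpen_setOf_realRow` — for a sharp bound, the set of `δ ∈ ℝ^K` carrying SOME real symmetric
  pencil with `≥ B + 1` positive roots is OPEN;
* the doors: `doorA26_iff_rpow`, `doorA34_iff_rpow` (+ the `Theses.LacunarySymmetroid` spellings),
  `isOpen_twentyLocus_two_six`, `isOpen_nineteenLocus_three_four`,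
  `doorA26_iff_twentyLocus_empty` — **`DoorA26` holds iff an explicitly described OPEN subset of
  `ℝ⁶` (the «all-supports residue», report DOOR-A-P1-REPORT §1/§10) is empty.**  This is the precise
  sense in which «all supports» is ONE compact problem (normalise `δ₀ = 0 < ⋯ < δ₅ = 1`) and in which
  a certificate closing a real cone of supports closes every integer support inside it; it is also why
  no reduction to a bounded window of integer supports can come from topology alone.

[folklore] Laguerre's count (tree Literature `Braess1986_VI_1_1_proper_holds`), Rolle, the
intermediate value theorem, density of `(1/D)ℤ^K`.
-/

-- `Summit.ValiantsHypothesis.ValiantsHypothesis.…` repeats a component by the D-0017 layout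
-- (single-conjunct summit), which the `dupNamespace` linter flags; the name is mandated.
set_option linter.dupNamespace false

namespace Summit.ValiantsHypothesis.ValiantsHypothesis.Theorems.LacunarySymmetroidMatrixDescartes.Census.RealExp

open Finset Filter Topology Polynomial
open scoped BigOperators Matrix
open Summit.ValiantsHypothesis.ValiantsHypothesis.Theorems.MatrixDescartes.Negative (PosRootLawAt)
open Summit.ValiantsHypothesis.ValiantsHypothesis.Theorems.SymmetroidDescartes (eval_det_pencil)

section Main

variable {m K : ℕ}

/-- **The sharp rows live over REAL exponents.**  If `#{λ : Fin m → Fin K monotone} ≤ B + 2` (the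
bound `B` is at least the Descartes ceiling minus one), then the integer-support row
`PosRootLawAt m K B` («every real symmetric `m × m` pencil with `K` lacunary terms has `≤ B` distinct
positive det-roots») is equivalent to the same statement for pencils `∑_l x^{δ_l} S_l` with arbitrary
REAL exponent vectors `δ : Fin K → ℝ` (`x > 0`, real powers; `Set.ncard`, which is `0` on an
infinite zero set — the identically vanishing determinant, as for the zero polynomial). [folklore] -/
theorem posRootLawAt_iff_rpow {B : ℕ}
    (hB : (univ.filter (fun lam : Fin m → Fin K => Monotone lam)).card ≤ B + 2) :
    PosRootLawAt m K B ↔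
      ∀ (δ : Fin K → ℝ) (S : Fin K → Matrix (Fin m) (Fin m) ℝ), (∀ l, (S l).IsSymm) →
        {x : ℝ | 0 < x ∧ (∑ l, (x ^ (δ l)) • S l).det = 0}.ncard ≤ B := by
  classical
  constructor
  · intro hlaw δ S hS
    by_contra hcon
    push Not at hcon
    rw [ncard_rpow_eq_ncard_exp δ S] at hcon
    obtain ⟨n, hnB, a, b, hab, hdisj, r, hr, hball⟩ :=
      exists_persistent_brackets hB δ S (by omega)
    -- a point of `(1/D) ℤ^K` in the ball
    set D : ℕ := ⌈1 / r⌉₊ + 1 with hD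
    have hD0 : 0 < D := Nat.succ_pos _
    have hDpos : (0 : ℝ) < D := by exact_mod_cast hD0
    have hDr : 1 / (D : ℝ) < r := by
      have h1 : 1 / r < (D : ℝ) := by
        rw [hD]; push_cast
        exact (Nat.le_ceil (1 / r)).trans_lt (lt_add_one _)
      exact (one_div_lt hDpos hr).mpr h1
    set z : Fin K → ℤ := fun l => ⌊δ l * D⌋ with hz
    have hdist : dist (fun l => (z l : ℝ) / D) δ < r := by
      rw [dist_pi_lt_iff hr]
      intro l
      rw [Real.dist_eq]
      have h1 : (z l : ℝ) ≤ δ l * D := Int.floor_le _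
      have h2 : δ l * D < (z l : ℝ) + 1 := Int.lt_floor_add_one _
      have heq : (z l : ℝ) / D - δ l = ((z l : ℝ) - δ l * D) / D := by field_simp
      have h3 : |(z l : ℝ) / D - δ l| ≤ 1 / D := by
        rw [heq, abs_le]
        constructor
        · rw [le_div_iff₀ hDpos]
          have : -(1 / (D : ℝ)) * D = -1 := by field_simp
          rw [this]; linarith
        · exact div_le_div_of_nonneg_right (by linarith) hDpos.le
      exact h3.trans_lt hDr
    have hsign := hball (fun l => (z l : ℝ) / D) hdist
    -- zeros of the perturbed pencil inside the brackets
    have hzeros : ∀ i, ∃ w ∈ Set.Ioo (a i) (b i),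
        (∑ l, Real.exp (((z l : ℝ) / D) * w) • S l).det = 0 :=
      fun i => exists_zero_of_mul_neg (hab i)
        (continuous_det_expPencil (fun l => (z l : ℝ) / D) S).continuousOn (hsign i)
    choose w hwmem hw0 using hzeros
    have hwmono : StrictMono w := by
      intro i j hij
      have h1 := (hwmem i).2
      have h2 := (hwmem j).1
      have h3 := hdisj i j hij
      linarith
    -- the integer support
    obtain ⟨e, he⟩ := exists_nat_support z hD0 S
    set P : ℝ[X] := (∑ l, (X : ℝ[X]) ^ e l • (S l).map C).det with hP
    have hProot : ∀ i, P.eval (Real.exp (w i / D)) = 0 := fun i => by rw [hP, he]; exact hw0 i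
    have hn0 : 0 < n := by omega
    have hPne : P ≠ 0 := by
      intro h0
      have h1 : P.eval (Real.exp (a ⟨0, hn0⟩ / D)) = 0 := by rw [h0, eval_zero]
      rw [hP, he] at h1
      have h2 := hsign ⟨0, hn0⟩
      rw [h1, zero_mul] at h2
      exact lt_irrefl 0 h2
    set xs : Fin n → ℝ := fun i => Real.exp (w i / D) with hxs
    have hxsinj : Function.Injective xs := by
      intro i j hij
      have h1 := Real.exp_injective hij
      have h2 : w i = w j := by
        have h3 : w i / D * D = w j / D * D := by rw [h1]
        rwa [div_mul_cancel₀ _ hDpos.ne', div_mul_cancel₀ _ hDpos.ne'] at h3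
      exact hwmono.injective h2
    have hsub : univ.image xs ⊆ P.roots.toFinset.filter (fun x => 0 < x) := by
      intro x hx
      rw [Finset.mem_image] at hx
      obtain ⟨i, -, rfl⟩ := hx
      rw [Finset.mem_filter, Multiset.mem_toFinset, mem_roots hPne, IsRoot.def]
      exact ⟨hProot i, Real.exp_pos _⟩
    have hcard := Finset.card_le_card hsub
    rw [Finset.card_image_of_injective _ hxsinj, Finset.card_univ, Fintype.card_fin] at hcard
    have hle := hlaw e S hS
    rw [← hP] at hle
    omega
  · intro hreal d S hS
    set P : ℝ[X] := (∑ l, (X : ℝ[X]) ^ d l • (S l).map C).det with hP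
    by_cases hP0 : P = 0
    · rw [hP0]; simp
    · have hset : (↑(P.roots.toFinset.filter (fun x => 0 < x)) : Set ℝ) =
          {x : ℝ | 0 < x ∧ (∑ l, (x ^ ((fun l => (d l : ℝ)) l)) • S l).det = 0} := by
        ext x
        rw [Finset.coe_filter, Set.mem_setOf_eq, Set.mem_setOf_eq, Multiset.mem_toFinset,
          mem_roots hP0, IsRoot.def, hP, eval_det_pencil]
        simp only [Real.rpow_natCast]
        exact and_comm
      have h := hreal (fun l => (d l : ℝ)) S hS
      rw [← hset, Set.ncard_coe_finset] at h
      exact h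

/-- **OPENNESS of the real-exponent residue.**  For a sharp bound (`#{monotone λ} ≤ B + 2`) the set of
real exponent vectors `δ ∈ ℝ^K` for which SOME real symmetric pencil `∑_l x^{δ_l} S_l` has at least
`B + 1` distinct positive det-roots is open: all roots of such a pencil are simple (sharpness), so
they are sign changes and persist, as `≥ B + 1` distinct roots, under every small perturbation of `δ`.
[folklore] -/
theorem isOpen_setOf_realRow {B : ℕ}
    (hB : (univ.filter (fun lam : Fin m → Fin K => Monotone lam)).card ≤ B + 2) :
    IsOpen {δ : Fin K → ℝ | ∃ S : Fin K → Matrix (Fin m) (Fin m) ℝ, (∀ l, (S l).IsSymm) ∧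
      B + 1 ≤ {x : ℝ | 0 < x ∧ (∑ l, (x ^ (δ l)) • S l).det = 0}.ncard} := by
  classical
  rw [Metric.isOpen_iff]
  rintro δ ⟨S, hS, hcount⟩
  rw [ncard_rpow_eq_ncard_exp δ S] at hcount
  obtain ⟨n, hnB, a, b, hab, hdisj, r, hr, hball⟩ := exists_persistent_brackets hB δ S hcount
  refine ⟨r, hr, fun δ' hδ' => ⟨S, hS, ?_⟩⟩
  rw [ncard_rpow_eq_ncard_exp δ' S]
  have h := le_ncard_of_brackets δ' S (by omega) hab hdisj (hball δ' (Metric.mem_ball.mp hδ'))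
  exact hnB.trans h.2

end Main

section Doors

/-- `#{λ : Fin 2 → Fin 6 monotone} = 21 = C(7,2)` (the Descartes count `D(2,6) + 1` of pair sums).
[folklore] -/
theorem card_monotone_two_six :
    (univ.filter (fun lam : Fin 2 → Fin 6 => Monotone lam)).card = 21 := by decide

/-- `#{λ : Fin 3 → Fin 4 monotone} = 20 = C(6,3)` (the Descartes count `D(3,4) + 1` of triple sums).
[folklore] -/
theorem card_monotone_three_four :
    (univ.filter (fun lam : Fin 3 → Fin 4 => Monotone lam)).card = 20 := by decide

/-- **`DoorA26` over real exponents.**  `DoorA26` (`ζ_sym(2,6) ≤ 19` for all INTEGER supports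
`d : Fin 6 → ℕ`) holds iff for every REAL exponent vector `δ : Fin 6 → ℝ` and every six real
symmetric `2 × 2` matrices `S_l` the function `x ↦ det ∑_l x^{δ_l} S_l` has at most `19` zeros on
`(0, ∞)` (or vanishes identically there).  The door is a statement about the compact simplex of
normalised real exponent vectors, not about a box of integer supports. [folklore] -/
theorem doorA26_iff_rpow :
    DoorA26 ↔ ∀ (δ : Fin 6 → ℝ) (S : Fin 6 → Matrix (Fin 2) (Fin 2) ℝ), (∀ l, (S l).IsSymm) →
      {x : ℝ | 0 < x ∧ (∑ l, (x ^ (δ l)) • S l).det = 0}.ncard ≤ 19 :=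
  posRootLawAt_iff_rpow (m := 2) (K := 6) (B := 19) (by rw [card_monotone_two_six])

/-- The route statement `Theses.LacunarySymmetroid.DoorA26` (stmt-ValiantsHypothesis-19979) over real
exponents — the same equivalence, stated against the Theses term (equal to `DoorA26` by `Iff.rfl`).
[folklore] -/
theorem theses_doorA26_iff_rpow :
    Summit.ValiantsHypothesis.ValiantsHypothesis.Theses.LacunarySymmetroid.DoorA26 ↔
      ∀ (δ : Fin 6 → ℝ) (S : Fin 6 → Matrix (Fin 2) (Fin 2) ℝ), (∀ l, (S l).IsSymm) →
        {x : ℝ | 0 < x ∧ (∑ l, (x ^ (δ l)) • S l).det = 0}.ncard ≤ 19 :=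
  doorA26_iff_rpow

/-- **`DoorA34` over real exponents**: `DoorA34` (`ζ_sym(3,4) ≤ 18` for all integer supports) holds
iff every real-exponent four-letter real symmetric `3 × 3` pencil `∑_l x^{δ_l} S_l` has at most `18`
zeros on `(0, ∞)` (or vanishes identically). [folklore] -/
theorem doorA34_iff_rpow :
    DoorA34 ↔ ∀ (δ : Fin 4 → ℝ) (S : Fin 4 → Matrix (Fin 3) (Fin 3) ℝ), (∀ l, (S l).IsSymm) →
      {x : ℝ | 0 < x ∧ (∑ l, (x ^ (δ l)) • S l).det = 0}.ncard ≤ 18 :=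
  posRootLawAt_iff_rpow (m := 3) (K := 4) (B := 18) (by rw [card_monotone_three_four])

/-- The route statement `Theses.LacunarySymmetroid.DoorA34` (stmt-ValiantsHypothesis-19980) over real
exponents. [folklore] -/
theorem theses_doorA34_iff_rpow :
    Summit.ValiantsHypothesis.ValiantsHypothesis.Theses.LacunarySymmetroid.DoorA34 ↔
      ∀ (δ : Fin 4 → ℝ) (S : Fin 4 → Matrix (Fin 3) (Fin 3) ℝ), (∀ l, (S l).IsSymm) →
        {x : ℝ | 0 < x ∧ (∑ l, (x ^ (δ l)) • S l).det = 0}.ncard ≤ 18 :=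
  doorA34_iff_rpow

/-- **The all-supports residue of `DoorA26` is open.**  The set of real exponent vectors
`δ ∈ ℝ⁶` for which some six-letter real symmetric `2 × 2` pencil `∑_l x^{δ_l} S_l` has `≥ 20` zeros
on `(0,∞)` is an open subset of `ℝ⁶` (empty iff `DoorA26`, by `doorA26_iff_twentyLocus_empty`).
[folklore] -/
theorem isOpen_twentyLocus_two_six :
    IsOpen {δ : Fin 6 → ℝ | ∃ S : Fin 6 → Matrix (Fin 2) (Fin 2) ℝ, (∀ l, (S l).IsSymm) ∧
      20 ≤ {x : ℝ | 0 < x ∧ (∑ l, (x ^ (δ l)) • S l).det = 0}.ncard} :=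
  isOpen_setOf_realRow (m := 2) (K := 6) (B := 19) (by rw [card_monotone_two_six])

/-- The all-supports residue of `DoorA34` is open in `ℝ⁴` (same statement at `(3,4)`, `≥ 19` zeros).
[folklore] -/
theorem isOpen_nineteenLocus_three_four :
    IsOpen {δ : Fin 4 → ℝ | ∃ S : Fin 4 → Matrix (Fin 3) (Fin 3) ℝ, (∀ l, (S l).IsSymm) ∧
      19 ≤ {x : ℝ | 0 < x ∧ (∑ l, (x ^ (δ l)) • S l).det = 0}.ncard} :=
  isOpen_setOf_realRow (m := 3) (K := 4) (B := 18) (by rw [card_monotone_three_four])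

/-- `DoorA26` in residue form: the door holds iff the open twenty-locus in `ℝ⁶` is empty.
[folklore] -/
theorem doorA26_iff_twentyLocus_empty :
    DoorA26 ↔ {δ : Fin 6 → ℝ | ∃ S : Fin 6 → Matrix (Fin 2) (Fin 2) ℝ, (∀ l, (S l).IsSymm) ∧
      20 ≤ {x : ℝ | 0 < x ∧ (∑ l, (x ^ (δ l)) • S l).det = 0}.ncard} = ∅ := by
  rw [doorA26_iff_rpow, Set.eq_empty_iff_forall_notMem]
  constructor
  · rintro h δ ⟨S, hS, h20⟩
    have := h δ S hS
    omega
  · intro h δ S hS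
    by_contra hcon
    exact h δ ⟨S, hS, by omega⟩

/-- `DoorA34` in residue form: the door holds iff the open nineteen-locus in `ℝ⁴` is empty.
[folklore] -/
theorem doorA34_iff_nineteenLocus_empty :
    DoorA34 ↔ {δ : Fin 4 → ℝ | ∃ S : Fin 4 → Matrix (Fin 3) (Fin 3) ℝ, (∀ l, (S l).IsSymm) ∧
      19 ≤ {x : ℝ | 0 < x ∧ (∑ l, (x ^ (δ l)) • S l).det = 0}.ncard} = ∅ := by
  rw [doorA34_iff_rpow, Set.eq_empty_iff_forall_notMem]
  constructor
  · rintro h δ ⟨S, hS, h19⟩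
    have := h δ S hS
    omega
  · intro h δ S hS
    by_contra hcon
    exact h δ ⟨S, hS, by omega⟩

end Doors

end Summit.ValiantsHypothesis.ValiantsHypothesis.Theorems.LacunarySymmetroidMatrixDescartes.Census.RealExp
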